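import Mathlib
import HarnessLib

/-!
# Stub `stub_spectralHeatVarianceUnbounded` of line `birth`
(crux `CageBudgetFekete.UnboundedHeatVariance`, item stmt-AtomisticToContinuum-15771; `--supports` file, closes
nothing; line `birth`, 2026-08-17)

WHAT. The registered stub S3 of the crux's skeleton (Cesàro–Fatou criterion, pure real analysis): for a finite
measure `ρ` on `ℝ` with an atom at `0` or with `ω ↦ (ω²)⁻¹` not `ρ`-integrable (Lean's `(0²)⁻¹ = 0`, so this is
`∫_{ω≠0} ω⁻² dρ = ∞`), the spectral heat variance `V(τ) = 2∫_{(0,τ]} (τ − s)(∫ cos(ωs) dρ(ω)) ds` is unbounded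
above on `τ ≥ 0`.

HOW. Fubini on the finite measure space `(0,τ] × ℝ` gives `V(τ) = ∫ k(ω,τ) dρ(ω)` with the Fejér-type kernel
`k(ω,τ) = τ²·sinc²(ωτ/2) = 2(1 − cos ωτ)/ω²` (`= τ²` at `ω = 0`; written inline, no definition is introduced),
computed by the fundamental theorem of calculus; `0 ≤ k ≤ τ²`, `k` jointly continuous.
An atom gives `V(τ) ≥ ρ{0}·τ²`. Otherwise, if `V ≤ R` on `[0,∞)`, Tonelli over `τ ∈ (0,T]` and the bound
`∫₀^T k(ω,τ)dτ = (2/ω²)(T − sin(ωT)/ω) ≥ T/ω²` for `|ω| ≥ 2/T` give `∫_{|ω| ≥ 2/T} ω⁻² dρ ≤ R` for every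
`T > 0`, whence `∫ ω⁻² dρ ≤ R < ∞` by monotone convergence — contradicting non-integrability.
[folklore; von Neumann mean-ergodic / coboundary dichotomy in spectral form]
-/

noncomputable section

namespace Summit.AtomisticToContinuum.FouriersLaw.Theorems.UnboundedHeatVariance.Birth

open MeasureTheory Set Filter Function
open scoped Topology ENNReal

/-! ### The kernel `k(ω,τ) = 2∫_{(0,τ]} (τ − s) cos(ωs) ds` in closed form -/

/-- The spectral heat-variance kernel `k(ω,τ) = τ²·sinc²(ωτ/2)` (written inline throughout) in the
Fejér form `2(1 − cos ωτ)/ω²` for `ω ≠ 0`. [folklore] -/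
theorem hvKernel_eq_of_ne_zero {w : ℝ} (hw : w ≠ 0) (τ : ℝ) :
    τ ^ 2 * Real.sinc (w * τ / 2) ^ 2 = 2 * (1 - Real.cos (w * τ)) / w ^ 2 := by
  by_cases hτ : τ = 0
  · subst hτ
    simp
  · have hx : w * τ / 2 ≠ 0 := div_ne_zero (mul_ne_zero hw hτ) two_ne_zero
    rw [Real.sinc_of_ne_zero hx, div_pow, Real.sin_sq_eq_half_sub,
      (by ring : 2 * (w * τ / 2) = w * τ)]
    field_simp

/-- The kernel at `ω = 0`: `k(0,τ) = τ²`. [folklore] -/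
theorem hvKernel_zero (τ : ℝ) : τ ^ 2 * Real.sinc (0 * τ / 2) ^ 2 = τ ^ 2 := by
  simp

/-- `d/ds sin(ωs) = ω cos(ωs)` in the form used below. [folklore] -/
theorem hasDerivAt_sin_const_mul (w s : ℝ) :
    HasDerivAt (fun s : ℝ => Real.sin (w * s)) (Real.cos (w * s) * w) s := by
  have h1 : HasDerivAt (fun s : ℝ => w * s) w s := by
    simpa using (hasDerivAt_id s).const_mul w
  exact (Real.hasDerivAt_sin (w * s)).comp s h1

/-- `d/ds cos(ωs) = -ω sin(ωs)` in the form used below. [folklore] -/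
theorem hasDerivAt_cos_const_mul (w s : ℝ) :
    HasDerivAt (fun s : ℝ => Real.cos (w * s)) (-Real.sin (w * s) * w) s := by
  have h1 : HasDerivAt (fun s : ℝ => w * s) w s := by
    simpa using (hasDerivAt_id s).const_mul w
  exact (Real.hasDerivAt_cos (w * s)).comp s h1

/-- Antiderivative for the kernel integrand: `d/ds [(τ − s) sin(ωs)/ω − cos(ωs)/ω²] = (τ − s) cos(ωs)`
(`ω ≠ 0`). [folklore] -/
theorem hasDerivAt_kernelPrimitive {w : ℝ} (hw : w ≠ 0) (τ s : ℝ) :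
    HasDerivAt (fun s : ℝ => (τ - s) * Real.sin (w * s) / w - Real.cos (w * s) / w ^ 2)
      ((τ - s) * Real.cos (w * s)) s := by
  have hlin : HasDerivAt (fun s : ℝ => τ - s) (-1) s := by
    simpa using (hasDerivAt_id s).const_sub τ
  have h : HasDerivAt (fun s : ℝ => (τ - s) * Real.sin (w * s) / w - Real.cos (w * s) / w ^ 2)
      ((-1 * Real.sin (w * s) + (τ - s) * (Real.cos (w * s) * w)) / w
        - -Real.sin (w * s) * w / w ^ 2) s :=
    ((hlin.fun_mul (hasDerivAt_sin_const_mul w s)).div_const w).fun_sub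
      ((hasDerivAt_cos_const_mul w s).div_const (w ^ 2))
  refine h.congr_deriv ?_
  field_simp
  ring

/-- The one-dimensional identity `∫_{(0,τ]} (τ − s) cos(ωs) ds = (1 − cos ωτ)/ω²` for `ω ≠ 0`, `τ ≥ 0`.
[folklore] -/
theorem integral_kernel_of_ne_zero {w : ℝ} (hw : w ≠ 0) {τ : ℝ} (hτ : 0 ≤ τ) :
    ∫ s in Ioc 0 τ, (τ - s) * Real.cos (w * s) = (1 - Real.cos (w * τ)) / w ^ 2 := by
  rw [← intervalIntegral.integral_of_le hτ,
    intervalIntegral.integral_eq_sub_of_hasDerivAt (fun s _ => hasDerivAt_kernelPrimitive hw τ s)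
      ((by fun_prop : Continuous fun s : ℝ => (τ - s) * Real.cos (w * s)).intervalIntegrable _ _)]
  simp only [sub_self, zero_mul, zero_div, zero_sub, mul_zero, Real.sin_zero, Real.cos_zero]
  ring

/-- The one-dimensional identity at `ω = 0`: `∫_{(0,τ]} (τ − s) ds = τ²/2` for `τ ≥ 0`. [folklore] -/
theorem integral_kernel_zero {τ : ℝ} (hτ : 0 ≤ τ) :
    ∫ s in Ioc 0 τ, (τ - s) * Real.cos (0 * s) = τ ^ 2 / 2 := by
  have hd : ∀ s ∈ uIcc 0 τ, HasDerivAt (fun s : ℝ => τ * s - s ^ 2 / 2) (τ - s) s := by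
    intro s _
    have h : HasDerivAt (fun s : ℝ => τ * s - s ^ 2 / 2) (τ * 1 - ↑(2 : ℕ) * s ^ (2 - 1) / 2) s :=
      ((hasDerivAt_id' s).const_mul τ).fun_sub ((hasDerivAt_pow 2 s).div_const 2)
    refine h.congr_deriv ?_
    push_cast
    ring
  simp only [zero_mul, Real.cos_zero, mul_one]
  rw [← intervalIntegral.integral_of_le hτ,
    intervalIntegral.integral_eq_sub_of_hasDerivAt hd
      ((by fun_prop : Continuous fun s : ℝ => τ - s).intervalIntegrable _ _)]
  ring

/-- `2∫_{(0,τ]} (τ − s) cos(ωs) ds = k(ω,τ) = τ²·sinc²(ωτ/2)` for `τ ≥ 0`. [folklore] -/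
theorem two_mul_integral_kernel (w : ℝ) {τ : ℝ} (hτ : 0 ≤ τ) :
    2 * ∫ s in Ioc 0 τ, (τ - s) * Real.cos (w * s) = τ ^ 2 * Real.sinc (w * τ / 2) ^ 2 := by
  by_cases hw : w = 0
  · subst hw
    rw [integral_kernel_zero hτ, hvKernel_zero]
    ring
  · rw [integral_kernel_of_ne_zero hw hτ, hvKernel_eq_of_ne_zero hw]
    ring

/-- The kernel is nonnegative. [folklore] -/
theorem hvKernel_nonneg (w τ : ℝ) : 0 ≤ τ ^ 2 * Real.sinc (w * τ / 2) ^ 2 := by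
  positivity

/-- The kernel is at most `τ²` (`|sinc| ≤ 1`). [folklore] -/
theorem hvKernel_le_sq (w τ : ℝ) : τ ^ 2 * Real.sinc (w * τ / 2) ^ 2 ≤ τ ^ 2 := by
  have h1 : Real.sinc (w * τ / 2) ^ 2 ≤ 1 := by
    rw [← sq_abs]
    exact pow_le_one₀ (abs_nonneg _) (Real.abs_sinc_le_one _)
  calc τ ^ 2 * Real.sinc (w * τ / 2) ^ 2 ≤ τ ^ 2 * 1 := mul_le_mul_of_nonneg_left h1 (sq_nonneg τ)
    _ = τ ^ 2 := mul_one _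

/-- The kernel is jointly continuous, hence jointly measurable. [folklore] -/
theorem measurable_hvKernel : Measurable fun p : ℝ × ℝ => p.2 ^ 2 * Real.sinc (p.1 * p.2 / 2) ^ 2 :=
  (by fun_prop : Continuous fun p : ℝ × ℝ => p.2 ^ 2 * Real.sinc (p.1 * p.2 / 2) ^ 2).measurable

/-- For a finite measure, `ω ↦ k(ω,τ)` is integrable (bounded by `τ²`). [folklore] -/
theorem integrable_hvKernel (ρ : Measure ℝ) [IsFiniteMeasure ρ] (τ : ℝ) :
    Integrable (fun w : ℝ => τ ^ 2 * Real.sinc (w * τ / 2) ^ 2) ρ := by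
  refine (integrable_const (τ ^ 2)).mono'
    (measurable_hvKernel.comp (measurable_id.prodMk measurable_const)).aestronglyMeasurable
    (ae_of_all _ fun w => ?_)
  rw [Real.norm_eq_abs, abs_of_nonneg (hvKernel_nonneg w τ)]
  exact hvKernel_le_sq w τ

/-! ### Fubini: the spectral heat variance is `∫ k(ω,τ) dρ(ω)` -/

/-- **Fubini.** For a finite measure `ρ` and `τ ≥ 0`,
`2∫_{(0,τ]} (τ − s)(∫ cos(ωs) dρ(ω)) ds = ∫ k(ω,τ) dρ(ω)`. [folklore] -/
theorem heatVariance_eq_integral_hvKernel (ρ : Measure ℝ) [IsFiniteMeasure ρ] {τ : ℝ} (hτ : 0 ≤ τ) :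
    2 * ∫ s in Ioc (0 : ℝ) τ, (τ - s) * (∫ w : ℝ, Real.cos (w * s) ∂ρ) =
      ∫ w, τ ^ 2 * Real.sinc (w * τ / 2) ^ 2 ∂ρ := by
  have hF : Integrable (uncurry fun (s w : ℝ) => (τ - s) * Real.cos (w * s))
      ((volume.restrict (Ioc (0 : ℝ) τ)).prod ρ) := by
    refine (integrable_const τ).mono' ?_ ?_
    · exact (by fun_prop : Continuous fun p : ℝ × ℝ => (τ - p.1) * Real.cos (p.2 * p.1)).aestronglyMeasurable
    · have hp : ∀ᵐ p : ℝ × ℝ ∂(volume.restrict (Ioc (0 : ℝ) τ)).prod ρ, p.1 ∈ Ioc (0 : ℝ) τ :=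
        (Measure.quasiMeasurePreserving_fst).ae (ae_restrict_mem measurableSet_Ioc)
      filter_upwards [hp] with p hp
      simp only [uncurry, Real.norm_eq_abs, abs_mul]
      calc |τ - p.1| * |Real.cos (p.2 * p.1)| ≤ τ * 1 := by
            refine mul_le_mul ?_ (Real.abs_cos_le_one _) (abs_nonneg _) hτ
            rw [abs_of_nonneg (sub_nonneg.2 hp.2)]
            linarith [hp.1]
        _ = τ := mul_one τ
  calc 2 * ∫ s in Ioc (0 : ℝ) τ, (τ - s) * (∫ w : ℝ, Real.cos (w * s) ∂ρ)
      = 2 * ∫ s in Ioc (0 : ℝ) τ, (∫ w : ℝ, (τ - s) * Real.cos (w * s) ∂ρ) := by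
        congr 1
        refine integral_congr_ae (ae_of_all _ fun s => ?_)
        exact (integral_const_mul _ _).symm
    _ = 2 * ∫ w : ℝ, (∫ s in Ioc (0 : ℝ) τ, (τ - s) * Real.cos (w * s)) ∂ρ := by
        rw [integral_integral_swap hF]
    _ = ∫ w : ℝ, 2 * (∫ s in Ioc (0 : ℝ) τ, (τ - s) * Real.cos (w * s)) ∂ρ :=
        (integral_const_mul _ _).symm
    _ = ∫ w, τ ^ 2 * Real.sinc (w * τ / 2) ^ 2 ∂ρ :=
        integral_congr_ae (ae_of_all _ fun w => two_mul_integral_kernel w hτ)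

/-! ### The Cesàro average of the kernel -/

/-- `∫_{(0,T]} 2(1 − cos ωτ)/ω² dτ = (2/ω²)(T − sin(ωT)/ω)` for `ω ≠ 0`, `T ≥ 0`. [folklore] -/
theorem integral_hvKernel_Ioc {w : ℝ} (hw : w ≠ 0) {T : ℝ} (hT : 0 ≤ T) :
    ∫ τ in Ioc 0 T, τ ^ 2 * Real.sinc (w * τ / 2) ^ 2 = 2 / w ^ 2 * (T - Real.sin (w * T) / w) := by
  have hk : (fun τ : ℝ => τ ^ 2 * Real.sinc (w * τ / 2) ^ 2) =
      fun τ => 2 * (1 - Real.cos (w * τ)) / w ^ 2 :=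
    funext fun τ => hvKernel_eq_of_ne_zero hw τ
  have hd : ∀ τ ∈ uIcc 0 T, HasDerivAt (fun τ : ℝ => 2 / w ^ 2 * (τ - Real.sin (w * τ) / w))
      (2 * (1 - Real.cos (w * τ)) / w ^ 2) τ := by
    intro τ _
    have h : HasDerivAt (fun τ : ℝ => 2 / w ^ 2 * (τ - Real.sin (w * τ) / w))
        (2 / w ^ 2 * (1 - Real.cos (w * τ) * w / w)) τ :=
      ((hasDerivAt_id' τ).fun_sub ((hasDerivAt_sin_const_mul w τ).div_const w)).const_mul (2 / w ^ 2)
    refine h.congr_deriv ?_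
    field_simp
  rw [hk, ← intervalIntegral.integral_of_le hT,
    intervalIntegral.integral_eq_sub_of_hasDerivAt hd
      ((by fun_prop : Continuous fun τ : ℝ => 2 * (1 - Real.cos (w * τ)) / w ^ 2).intervalIntegrable
        _ _)]
  simp

/-- Lower bound on the Cesàro average: `T/ω² ≤ ∫_{(0,T]} k(ω,τ) dτ` whenever `2/T ≤ |ω|`, `T > 0`.
[folklore] -/
theorem div_sq_le_integral_hvKernel_Ioc {w T : ℝ} (hT : 0 < T) (hw : 2 / T ≤ |w|) :
    T / w ^ 2 ≤ ∫ τ in Ioc 0 T, τ ^ 2 * Real.sinc (w * τ / 2) ^ 2 := by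
  have h2T : 0 < 2 / T := div_pos two_pos hT
  have hw0 : w ≠ 0 := by
    intro h
    rw [h, abs_zero] at hw
    linarith
  rw [integral_hvKernel_Ioc hw0 hT.le]
  have h1 : Real.sin (w * T) / w ≤ T / 2 := by
    calc Real.sin (w * T) / w ≤ |Real.sin (w * T) / w| := le_abs_self _
      _ = |Real.sin (w * T)| / |w| := abs_div _ _
      _ ≤ 1 / |w| := by
          gcongr
          exact Real.abs_sin_le_one _
      _ ≤ 1 / (2 / T) := one_div_le_one_div_of_le h2T hw
      _ = T / 2 := one_div_div _ _
  have h3 : T / w ^ 2 = 2 / w ^ 2 * (T - T / 2) := by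
    field_simp
    ring
  rw [h3]
  have h4 : 0 ≤ 2 / w ^ 2 := by positivity
  exact mul_le_mul_of_nonneg_left (by linarith) h4

/-! ### The averaging bound and the main theorem -/

/-- **Averaging bound.** If `∫ k(ω,τ) dρ(ω) ≤ R` for all `τ ≥ 0`, then for every `T > 0`,
`∫_{2/T ≤ |ω|} (ω²)⁻¹ dρ ≤ R` (Tonelli over `(0,T] × ℝ` and the Cesàro lower bound). [folklore] -/
theorem setLIntegral_inv_sq_le (ρ : Measure ℝ) [IsFiniteMeasure ρ] {R : ℝ}
    (hV : ∀ τ : ℝ, 0 ≤ τ → ∫ w, τ ^ 2 * Real.sinc (w * τ / 2) ^ 2 ∂ρ ≤ R) {T : ℝ} (hT : 0 < T) :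
    ∫⁻ w in {w : ℝ | 2 / T ≤ |w|}, ENNReal.ofReal ((w ^ 2)⁻¹) ∂ρ ≤ ENNReal.ofReal R := by
  -- the kernel, as a local abbreviation
  set k : ℝ → ℝ → ℝ := fun w τ => τ ^ 2 * Real.sinc (w * τ / 2) ^ 2 with hk_def
  -- pointwise in `τ`: the lintegral form of the hypothesis
  have h1 : ∀ τ : ℝ, 0 ≤ τ → ∫⁻ w, ENNReal.ofReal (k w τ) ∂ρ ≤ ENNReal.ofReal R := by
    intro τ hτ
    rw [← ofReal_integral_eq_lintegral_ofReal (integrable_hvKernel ρ τ)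
      (ae_of_all _ fun w => hvKernel_nonneg w τ)]
    exact ENNReal.ofReal_le_ofReal (hV τ hτ)
  -- integrate over `τ ∈ (0,T]`
  have h2 : ∫⁻ τ in Ioc (0 : ℝ) T, (∫⁻ w, ENNReal.ofReal (k w τ) ∂ρ) ≤
      ENNReal.ofReal T * ENNReal.ofReal R := by
    calc ∫⁻ τ in Ioc (0 : ℝ) T, (∫⁻ w, ENNReal.ofReal (k w τ) ∂ρ)
        ≤ ∫⁻ _ in Ioc (0 : ℝ) T, ENNReal.ofReal R :=
          setLIntegral_mono' measurableSet_Ioc fun τ hτ => h1 τ hτ.1.le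
      _ = ENNReal.ofReal T * ENNReal.ofReal R := by
          rw [setLIntegral_const, Real.volume_Ioc, sub_zero, mul_comm]
  -- Tonelli
  have hmeas : Measurable fun p : ℝ × ℝ => ENNReal.ofReal (k p.2 p.1) :=
    ENNReal.measurable_ofReal.comp (measurable_hvKernel.comp measurable_swap)
  have h3 : ∫⁻ τ in Ioc (0 : ℝ) T, (∫⁻ w, ENNReal.ofReal (k w τ) ∂ρ) =
      ∫⁻ w, (∫⁻ τ in Ioc (0 : ℝ) T, ENNReal.ofReal (k w τ)) ∂ρ :=
    lintegral_lintegral_swap hmeas.aemeasurable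
  -- the Cesàro lower bound, pointwise on `{2/T ≤ |ω|}`
  have h4 : ∀ w ∈ {w : ℝ | 2 / T ≤ |w|}, ENNReal.ofReal T * ENNReal.ofReal ((w ^ 2)⁻¹) ≤
      ∫⁻ τ in Ioc (0 : ℝ) T, ENNReal.ofReal (k w τ) := by
    intro w hw
    have hint : IntegrableOn (fun τ => k w τ) (Ioc (0 : ℝ) T) :=
      (by rw [hk_def]; fun_prop : Continuous fun τ : ℝ => k w τ).integrableOn_Ioc
    rw [mem_setOf_eq] at hw
    rw [← ENNReal.ofReal_mul hT.le, ← ofReal_integral_eq_lintegral_ofReal hint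
      (ae_of_all _ fun τ => hvKernel_nonneg w τ)]
    refine ENNReal.ofReal_le_ofReal ?_
    have h := div_sq_le_integral_hvKernel_Ioc hT hw
    rwa [div_eq_mul_inv] at h
  have hA : MeasurableSet {w : ℝ | 2 / T ≤ |w|} :=
    measurableSet_le measurable_const continuous_abs.measurable
  have h5 : ENNReal.ofReal T * ∫⁻ w in {w : ℝ | 2 / T ≤ |w|}, ENNReal.ofReal ((w ^ 2)⁻¹) ∂ρ ≤
      ENNReal.ofReal T * ENNReal.ofReal R := by
    calc ENNReal.ofReal T * ∫⁻ w in {w : ℝ | 2 / T ≤ |w|}, ENNReal.ofReal ((w ^ 2)⁻¹) ∂ρ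
        = ∫⁻ w in {w : ℝ | 2 / T ≤ |w|}, ENNReal.ofReal T * ENNReal.ofReal ((w ^ 2)⁻¹) ∂ρ := by
          rw [lintegral_const_mul]
          exact ENNReal.measurable_ofReal.comp ((measurable_id.pow_const 2).inv)
      _ ≤ ∫⁻ w in {w : ℝ | 2 / T ≤ |w|}, (∫⁻ τ in Ioc (0 : ℝ) T, ENNReal.ofReal (k w τ)) ∂ρ :=
          setLIntegral_mono' hA h4
      _ ≤ ∫⁻ w, (∫⁻ τ in Ioc (0 : ℝ) T, ENNReal.ofReal (k w τ)) ∂ρ :=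
          setLIntegral_le_lintegral _ _
      _ ≤ ENNReal.ofReal T * ENNReal.ofReal R := by
          rw [← h3]
          exact h2
  have hT0 : ENNReal.ofReal T ≠ 0 := by
    rw [Ne, ENNReal.ofReal_eq_zero, not_le]
    exact hT
  exact (ENNReal.mul_le_mul_iff_right hT0 ENNReal.ofReal_ne_top).1 h5

/-- **S3 — `stub_spectralHeatVarianceUnbounded` (Cesàro–Fatou criterion; pure real analysis).** For a finite
measure `ρ` on `ℝ` with an atom at `0` or `∫_{ω≠0} ω⁻² dρ = ∞`, the spectral heat variance
`τ ↦ 2∫₀^τ (τ − s)(∫ cos(ωs) dρ(ω)) ds = ∫ 2(1 − cos ωτ)/ω² dρ(ω)` is unbounded above on `τ ≥ 0`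
(Fubini; an atom gives `≥ ρ{0}τ²`; otherwise the Cesàro means `T⁻¹∫₀^T V ≥ ∫_{|ω|≥2/T} ω⁻² dρ ↑ ∞` by
monotone convergence). [folklore; von Neumann mean-ergodic / coboundary dichotomy in spectral form] -/
theorem stub_spectralHeatVarianceUnbounded :
    ∀ ρ : MeasureTheory.Measure ℝ, MeasureTheory.IsFiniteMeasure ρ → (0 < ρ {0} ∨ ¬ MeasureTheory.Integrable (fun w : ℝ => (w ^ 2)⁻¹) ρ) → ∀ R : ℝ, ∃ τ : ℝ, 0 ≤ τ ∧ R < 2 * ∫ s in Set.Ioc (0:ℝ) τ, (τ - s) * (∫ w : ℝ, Real.cos (w * s) ∂ρ) := by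
  intro ρ hρ hdisj R
  by_contra h
  push Not at h
  have hV : ∀ τ : ℝ, 0 ≤ τ → ∫ w, τ ^ 2 * Real.sinc (w * τ / 2) ^ 2 ∂ρ ≤ R := fun τ hτ => by
    rw [← heatVariance_eq_integral_hvKernel ρ hτ]
    exact h τ hτ
  rcases hdisj with hatom | hnint
  · -- an atom at `0`: `V(τ) ≥ ρ{0}·τ²`
    set c : ℝ := (ρ {0}).toReal with hc_def
    have hc : 0 < c := ENNReal.toReal_pos hatom.ne' (measure_ne_top ρ _)
    have hlow : ∀ τ : ℝ, 0 ≤ τ → c * τ ^ 2 ≤ ∫ w, τ ^ 2 * Real.sinc (w * τ / 2) ^ 2 ∂ρ := by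
      intro τ hτ
      calc c * τ ^ 2 = ∫ w in ({0} : Set ℝ), τ ^ 2 ∂ρ := by
            rw [setIntegral_const, smul_eq_mul, measureReal_def]
        _ = ∫ w in ({0} : Set ℝ), τ ^ 2 * Real.sinc (w * τ / 2) ^ 2 ∂ρ := by
            refine setIntegral_congr_fun (measurableSet_singleton 0) fun w hw => ?_
            rw [mem_singleton_iff] at hw
            rw [hw, hvKernel_zero]
        _ ≤ ∫ w, τ ^ 2 * Real.sinc (w * τ / 2) ^ 2 ∂ρ :=
            setIntegral_le_integral (integrable_hvKernel ρ τ) (ae_of_all _ fun w => hvKernel_nonneg w τ)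
    set τ : ℝ := max 1 (R / c + 1) with hτ_def
    have hτ1 : 1 ≤ τ := le_max_left _ _
    have hτ2 : R / c < τ := lt_of_lt_of_le (lt_add_one _) (le_max_right _ _)
    have hτ0 : 0 ≤ τ := le_trans zero_le_one hτ1
    have hR : R < c * τ ^ 2 := by
      have h1 : R < c * τ := by
        rw [div_lt_iff₀ hc] at hτ2
        linarith
      have h2 : c * τ ≤ c * τ ^ 2 := by
        apply mul_le_mul_of_nonneg_left _ hc.le
        nlinarith
      linarith
    linarith [hlow τ hτ0, hV τ hτ0]
  · -- `∫_{ω≠0} ω⁻² dρ = ∞`: the averaging bound and monotone convergence force integrability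
    apply hnint
    set g : ℝ → ℝ≥0∞ := fun w => ENNReal.ofReal ((w ^ 2)⁻¹) with hg_def
    -- the sets `{2/(n+1) ≤ |ω|}` increase to `{ω ≠ 0}`
    set A : ℕ → Set ℝ := fun n => {w : ℝ | 2 / ((n : ℝ) + 1) ≤ |w|} with hA_def
    have hAmono : Monotone A := by
      intro n m hnm w hw
      simp only [hA_def, mem_setOf_eq] at hw ⊢
      refine le_trans ?_ hw
      gcongr
    have hAn : ∀ n : ℕ, ∫⁻ w in A n, g w ∂ρ ≤ ENNReal.ofReal R := fun n =>
      setLIntegral_inv_sq_le ρ hV (by positivity : (0 : ℝ) < (n : ℝ) + 1)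
    have hcompl : ({0} : Set ℝ)ᶜ ⊆ ⋃ n, A n := by
      intro w hw
      rw [mem_compl_iff, mem_singleton_iff] at hw
      have hw' : 0 < |w| := abs_pos.2 hw
      obtain ⟨n, hn⟩ := exists_nat_ge (2 / |w|)
      refine mem_iUnion.2 ⟨n, ?_⟩
      simp only [hA_def, mem_setOf_eq]
      rw [div_le_iff₀ (by positivity : (0 : ℝ) < (n : ℝ) + 1)]
      rw [div_le_iff₀ hw'] at hn
      nlinarith
    have hzero : ∫⁻ w in ({0} : Set ℝ), g w ∂ρ = 0 := by
      rw [lintegral_singleton]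
      simp [hg_def]
    have hbound : ∫⁻ w, g w ∂ρ ≤ ENNReal.ofReal R := by
      calc ∫⁻ w, g w ∂ρ = ∫⁻ w in ({0} : Set ℝ), g w ∂ρ + ∫⁻ w in ({0} : Set ℝ)ᶜ, g w ∂ρ :=
            (lintegral_add_compl g (measurableSet_singleton 0)).symm
        _ = ∫⁻ w in ({0} : Set ℝ)ᶜ, g w ∂ρ := by rw [hzero, zero_add]
        _ ≤ ∫⁻ w in ⋃ n, A n, g w ∂ρ := lintegral_mono_set hcompl
        _ = ⨆ n, ∫⁻ w in A n, g w ∂ρ := setLIntegral_iUnion_of_directed g hAmono.directed_le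
        _ ≤ ENNReal.ofReal R := iSup_le hAn
    refine ⟨((measurable_id.pow_const 2).inv).aestronglyMeasurable, ?_⟩
    rw [hasFiniteIntegral_iff_ofReal (ae_of_all _ fun w => by positivity)]
    exact lt_of_le_of_lt hbound ENNReal.ofReal_lt_top

end Summit.AtomisticToContinuum.FouriersLaw.Theorems.UnboundedHeatVariance.Birth

end
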